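import Summits.ABC.IUTFork.Repair.RHTameBandLicence
import Summits.ABC.IUTFork.Repair.RHSigmaLicence
import Summits.ABC.IUTFork.Cor312PinnedHonestReal
import Summits.ABC.IUTFork.Cor312PilotIdelesPrProfile
import HarnessLib

/-!
# IUT REPAIR branch → R-H ROUND 2, Q2(5): row 5 «tame-band-licence» — the PACKET STRATUM `Σ₅`, «S_H restricted to Σ₅» PROVED at the genuine
# bed from the H⋆₅ cells, and the weakened Corollary «−|log(q)| ≤ −|log(Θ)| + R_{Σ₅}» with `R_{Σ₅} ≤` the off-Σ₅ Θ–q floor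

Seat abc-iut-rh-typ-5 (gen 3; R-H ROUND 2 tranche 1, director-abc g3 2026-08-26T19:46:32Z item (3) «rh-typ-5 ← rows 5 + 16: type 'S restricted
to Σ_row ⇒ (weakened) Cor 3.12 ⇒ abc-with-worse-constant' as a kernel target over settingPrVolSharp / pilotDataOfK»; ROUND2/START-HERE.md v1.1 §0
row 5 «PACKET (place) within a datum»; rh2-q2-eq 21:09:02Z «row 5 cited from rh-typ-5 g3 by name (no rival file)»). ROUND-1 READING OF RECORD
(rh-lead 19:59:53Z, ROUND1.tsv row 5, signed rh-ref-2): «Σ₅ = tame/ball packets where the band holds»; row 5 is an EQUIVALENCE on its stratum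
(`RH.TameBandLicence.licence_settingPrVolSharp_pilotDataOfK_iff_hStar_of_tame`, p458742 ✓). Consumed BY NAME (no restatement): rh2-q2-eq's
`RH.SigmaLicence` (p468453), round 1's `RH.TameBandLicence.Cell` / `HStarTameBandLicence` / `cell_iff_tame_exact`, abc-iut-w5-d180's per-packet
tame movers, abc-iut-w4-d006's per-place star refutation, abc-iut-C-cert-1's `PinnedHonestReal.scaled_settingPrVolSharp`, abc-iut-c312-7's
`bridgeHyps_settingPrVolSharp_of_ideles` / `qLocal_settingPrVolSharp_nonpos`, abc-iut-w5-d236's `norm_{q,theta}Idele_eq_rpow_of_realises`.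

WHAT IS TYPED / PROVED (`X := Cor312Prov.pilotDataOfK D K`; Θ- and q-ideles `t`, `tq` REALISING the pilot divisors; the WINDOW BED
`P := Thm311.Real.settingPrVolSharp X …`; cells `(i, v_ℚ)`, label `j = i+1 ∈ 𝔽_l^⋇`):
* §1 `UniformlyTameAt D p` (`p > 2`, all places of `K` over `p` share `e_p ≤ p − 2`); **`sigmaFive D`** = Σ₅: archimedean packets, packets
  over primes under NO bad place, and packets `(i, p)` over a uniformly tame `p` whose every BAD `w ∣ p` satisfies the H⋆₅ cell `Cell e_w P_w (i+1)`
  (`P_w = P_q(w) ∈ ℕ`); `mem_sigmaFive_of_hStar` (under H⋆₅: off Σ₅ = the wild / boundary / mixed-fibre bad packets, where the row claims nothing).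
* §2 **`licenceOn_sigmaFive` — «S_H RESTRICTED TO Σ₅» HOLDS** (`LicenceOn P (sigmaFive D)`, PROVED: trivial archimedean container, identity movers
  over good primes, w5-d180's multi-slot movers at tame packets fed with the cell via `cell_iff_tame_exact` and `‖t_{Θ,j,w}‖ = ‖ϖ_w‖^{j²P_w}`,
  `‖t_{q,w}‖ = ‖ϖ_w‖^{P_w}`); conversely a violated cell REFUTES the licence (w4-d006's star form), whence
  **`mem_sigmaFive_iff_mem_licenceCells_of_uniformlyTame`**: on uniformly tame packets Σ₅ IS the set of licence cells («TRUE precisely on Σ₅»).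
* §3 **`statementUpTo_offRemainder_sigmaFive` — THE WEAKENED COROLLARY** `StatementUpTo P (offRemainder P (sigmaFive D))` (PROVED):
  «`−|log(Θ)| ∈ ℝ ∧ −|log(q)| ≤ −|log(Θ)| + R_{Σ₅}`».
* §4 **`offRemainder_le_offFloor`** (any σ, PROVED): `R_σ ≤ PN(i ↦ Σᶠ_{v_ℚ} 1_{σᶜ}(i,v_ℚ)·((i+1)² − 1)·(−qLocal_{i+1,v_ℚ}))` (q2-eq's
  `offRemainder_le_offImageGap` along the (Ind3)-region + honest scaling `(i+1)²·qLocal`); `statementUpTo_offFloor_sigmaFive`. Genuine currency: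
  `−qLocal_{j,p} = (1/[K:ℚ])·Σ_{x|p} P_q(x)·log N(x)` (c312-7), so for row 5 the charge is `((l²+l−12)/(24l))·log(q_{off Σ₅})`.
DOWNSTREAM (by name): rh2-q2-cond's `Conditional.Cor312Slack.ABC_of_cor312Slack_of_hullRegime` (p469667: a datum-level slack
`≤ ((l+1)/4)·5·d*·l` is FREE in [IUTchIV] Thm. 1.10's display; twin p470106 `RH.OffSigmaDisplay…`) ∘ rh2-q2-eq's `GenuineK.cor312UpTo_of_licenceOn`
(p470233) give «(∀ admissible (P,l), ∀ genuine T: off-Σ₅ floor ≤ Tol(P,l)) ∧ hreg ⟹ ABC» (sequel file); the live hypothesis is the SIZE of the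
off-Σ₅ floor (Q3: off-Σ₅ = wild bad primes, `p ≤ e_w + 1 ≤ d*·l`, [IUTchIV] (R4)). HONEST FRAMING: `UniformlyTameAt`, `sigmaFive` are READING
PREDICATES over OUR typed objects; H⋆₅ is a HYPOTHESIS; nothing here asserts that abc is proved or refuted, or that [IUTchIII] Cor. 3.12 holds or
fails at any datum, or takes a side on any author; typed ≠ proved; instantiated ≠ endorsed; refuted-as-typed ≠ refuted-in-print.
[cite: Mochizuki2012, IUTchI Ex. 3.2 (iv) p. 71; IUTchIII Cor. 3.12 p. 173–174, Step (xi-f) p. 184, Prop. 3.9 (i)(iii) p. 116; IUTchIV Prop. 1.2 (i)(ii)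
p. 10, Thm. 1.10 Step (v) p. 27–29] [cite: DupuyHilado2025, §3.3, §3.4, §3.9, §4.9] [claim: Mochizuki2012, status: disputed]. Axioms: standard.
-/
noncomputable section
open Set Metric Function NumberField IsDedekindDomain
open scoped Pointwise

namespace Summit.ABC.IUTFork.Repair.RH.TameBandLicenceSigma

open Literature.AnabelianGeometry.AbsoluteAnabelian Literature.IUT.LogThetaLattice Literature.IUT.LogVolume
  Literature.IUT.HodgeTheaters Literature.NumberTheory.NumberFields Literature.NumberTheory.GaloisRepresentations.Ultrametric
open Summit.ABC.IUTFork.Thm311 Summit.ABC.IUTFork.Thm311.Real Summit.ABC.IUTFork.Cor312 Summit.ABC.IUTFork.Cor312.Setting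
  Summit.ABC.IUTFork.Cor312Vol Summit.ABC.IUTFork.Cor312Prov Summit.ABC.IUTFork.Repair.RH.TameBandLicence
  Summit.ABC.IUTFork.Repair.RH.SigmaLicence

variable {F K Fbar : Type} [Field F] [NumberField F] [Field K] [NumberField K] [Algebra F K] [Field Fbar]
  [Algebra F Fbar] [Algebra K Fbar] {E : WeierstrassCurve F} [E.IsElliptic] {l : ℕ} {Pb : BadPlacePredicates K}
  (D : InitialThetaData F K Fbar E l Pb)
/-! ## §1. The row-5 packet stratum `Σ₅` over the genuine `K`-level datum -/

/-- **`UniformlyTameAt D p`** — the prime `p` is odd and EVERY place of `K` over `p` has the same absolute ramification index `e_p ≤ p − 2`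
(the TAME hypothesis of round 1's `licence_settingPrVolSharp_pilotDataOfK_iff_hStar_of_tame`, read per prime). READING PREDICATE over the
genuine datum `pilotDataOfK D K`; no claim that any prime satisfies it. [cite: Mochizuki2012, IUTchIV Prop. 1.2 (i)(ii) p. 10]
[claim: Mochizuki2012, status: disputed] -/
@[claim "Mochizuki2012" "disputed"]
def UniformlyTameAt (pp : Nat.Primes) : Prop :=
  haveI : Fact (pp : ℕ).Prime := ⟨pp.2⟩
  2 < (pp : ℕ) ∧ ∃ e : ℕ, e ≤ (pp : ℕ) - 2 ∧
    ∀ x : (thetaIndex (pilotDataOfK D K)).Fibre (.inr pp), (placeOf (pilotDataOfK D K) pp.1 x).asIdeal.ramificationIdx ℤ = e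

/-- **`sigmaFive D` — THE ROW-5 STRATUM `Σ₅`** (cells `(i, v_ℚ)`, label `j = i+1 ∈ 𝔽_l^⋇`): every archimedean packet; every packet over a prime
under NO bad place of `pilotDataOfK D K`; and the packets `(i, p)` over a UNIFORMLY TAME prime `p` at which every BAD place `w ∣ p` satisfies
round 1's H⋆₅ cell `Cell e_w P_w (i+1)` for the integral q-degree `P_w = P_q(w)` («tame packets where the band holds», ROUND1.tsv row 5). No
wild / boundary / mixed-fibre bad packet is in Σ₅ (the row makes no claim there). READING PREDICATE; never asserted.
[cite: Mochizuki2012, IUTchIII Cor. 3.12 Step (xi-f) p. 184; IUTchIV Prop. 1.2 (i)(ii) p. 10] [claim: Mochizuki2012, status: disputed] -/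
@[claim "Mochizuki2012" "disputed"]
def sigmaFive : Set (Fin (thetaIndex (pilotDataOfK D K)).lstar × (thetaIndex (pilotDataOfK D K)).VQ) :=
  {c | match c.2 with
    | .inl _ => True
    | .inr pp =>
      haveI : Fact (pp : ℕ).Prime := ⟨pp.2⟩
      (∀ w : (thetaIndex (pilotDataOfK D K)).Fibre (.inr pp), placeOf (pilotDataOfK D K) pp.1 w ∉ (pilotDataOfK D K).S) ∨
        (UniformlyTameAt D pp ∧
          ∀ w : (thetaIndex (pilotDataOfK D K)).Fibre (.inr pp), placeOf (pilotDataOfK D K) pp.1 w ∈ (pilotDataOfK D K).S →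
            ∀ P : ℕ, (pilotDataOfK D K).qPilot (placeOf (pilotDataOfK D K) pp.1 w) = P →
              Cell (((placeOf (pilotDataOfK D K) pp.1 w).asIdeal.ramificationIdx ℤ : ℕ) : ℤ) (P : ℤ) (((c.1 : ℕ) + 1 : ℕ) : ℤ))}

/-- Membership of a prime packet in Σ₅, unfolded. [folklore] -/
theorem mem_sigmaFive_inr_iff (i : Fin (thetaIndex (pilotDataOfK D K)).lstar) (pp : Nat.Primes) :
    (i, Sum.inr pp) ∈ sigmaFive D ↔
      haveI : Fact (pp : ℕ).Prime := ⟨pp.2⟩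
      (∀ w : (thetaIndex (pilotDataOfK D K)).Fibre (.inr pp), placeOf (pilotDataOfK D K) pp.1 w ∉ (pilotDataOfK D K).S) ∨
        (UniformlyTameAt D pp ∧
          ∀ w : (thetaIndex (pilotDataOfK D K)).Fibre (.inr pp), placeOf (pilotDataOfK D K) pp.1 w ∈ (pilotDataOfK D K).S →
            ∀ P : ℕ, (pilotDataOfK D K).qPilot (placeOf (pilotDataOfK D K) pp.1 w) = P →
              Cell (((placeOf (pilotDataOfK D K) pp.1 w).asIdeal.ramificationIdx ℤ : ℕ) : ℤ) (P : ℤ) (((i : ℕ) + 1 : ℕ) : ℤ)) :=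
  Iff.rfl

/-- **Under H⋆₅ every packet over a uniformly tame prime is in Σ₅** (so off Σ₅ = the wild / boundary / mixed-fibre bad packets).
[claim: Mochizuki2012, status: disputed] -/
theorem mem_sigmaFive_of_hStar (hH : HStarTameBandLicence D) (i : Fin (thetaIndex (pilotDataOfK D K)).lstar) (pp : Nat.Primes)
    (htame : UniformlyTameAt D pp) : (i, Sum.inr pp) ∈ sigmaFive D := by
  haveI : Fact (pp : ℕ).Prime := ⟨pp.2⟩
  refine (mem_sigmaFive_inr_iff D i pp).2 (Or.inr ⟨htame, fun w hw P hP => ?_⟩)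
  obtain ⟨hp2, e, hep, he⟩ := htame
  exact hH pp i w hw hp2 (by rw [he w]; exact hep) P hP

/-! ## §2. «S_H restricted to Σ₅» HOLDS at the window bed with realising ideles; and Σ₅ is exact on the uniformly tame packets -/
variable {logv : PadicLogs K} (hlog : LogvAnalytic logv)
  (M : Type) [Field M] [NumberField M]
  (archPk : ∀ (j : (thetaIndex (pilotDataOfK D K)).Label) (vQ : (thetaIndex (pilotDataOfK D K)).VQ),
    Set ((logShellsDH (pilotDataOfK D K) logv).Packet j vQ))
  (archSub : ∀ (j : (thetaIndex (pilotDataOfK D K)).Label) (v : (thetaIndex (pilotDataOfK D K)).V),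
    Set ((logShellsDH (pilotDataOfK D K) logv).Packet j ((thetaIndex (pilotDataOfK D K)).over v)))
  (Ψ : ℤ → ∀ v : (thetaIndex (pilotDataOfK D K)).V, v ∈ (thetaIndex (pilotDataOfK D K)).Vbad →
    Set ((logShellsDH (pilotDataOfK D K) logv).StarPacket v))
  (act : ℤ → ∀ v : (thetaIndex (pilotDataOfK D K)).V, v ∈ (thetaIndex (pilotDataOfK D K)).Vbad →
    (logShellsDH (pilotDataOfK D K) logv).StarPacket v → Module.End ℚ ((logShellsDH (pilotDataOfK D K) logv).StarPacket v))
  (Mmod : ℤ → ∀ j : (thetaIndex (pilotDataOfK D K)).LabelStar, Set ((logShellsDH (pilotDataOfK D K) logv).GlobalPacket j.1))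
  (region : ℤ → ∀ j : (thetaIndex (pilotDataOfK D K)).LabelStar, FinDivisor M → ∀ vQ : (thetaIndex (pilotDataOfK D K)).VQ,
    Set ((logShellsDH (pilotDataOfK D K) logv).Packet j.1 vQ))
  (n : ℤ) {HT : Type} {LogLink : HT → HT → Type} {IsFull : ∀ {s t : HT}, LogLink s t → Prop}
  (lat : LGPGaussianLogThetaLattice LogLink IsFull)
  {Frd : Type} {IsoF : Frd → Frd → Type} {Ob : Frd → Type} {realify : Frd → Frd} {Strip : Type}
  {IsoS : Strip → Strip → Type} {Mv : ∀ v : (thetaIndex (pilotDataOfK D K)).V, v ∈ (thetaIndex (pilotDataOfK D K)).Vbad → Type}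
  [∀ v h, Monoid (Mv v h)]
  (sig : GlobalLGPFrobenioidSignature (thetaIndex (pilotDataOfK D K)).lstar (thetaIndex (pilotDataOfK D K)).V
    (· ∈ (thetaIndex (pilotDataOfK D K)).Vbad) Frd IsoF Ob realify Strip IsoS Mv)
  (split : SplittingMonoids Mv) {ObΔ : Type} {N : ∀ v : (thetaIndex (pilotDataOfK D K)).V, v ∈ (thetaIndex (pilotDataOfK D K)).Vbad → Type}
  [∀ v h, Monoid (N v h)] (qData : QPilotData ObΔ N)
  (tq : ∀ (pp : Nat.Primes) (x : (thetaIndex (pilotDataOfK D K)).Fibre (.inr pp)),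
    haveI : Fact (pp : ℕ).Prime := ⟨pp.2⟩; kOf (pilotDataOfK D K) pp.1 x)
  (t : ∀ (pp : Nat.Primes) (_ : Fin (pilotDataOfK D K).lstar) (x : (thetaIndex (pilotDataOfK D K)).Fibre (.inr pp)),
    haveI : Fact (pp : ℕ).Prime := ⟨pp.2⟩; kOf (pilotDataOfK D K) pp.1 x)
  (htq0 : ∀ pp x, tq pp x ≠ 0)
  (htq1 : ∀ (pp : Nat.Primes) (x : (thetaIndex (pilotDataOfK D K)).Fibre (.inr pp)),
    haveI : Fact (pp : ℕ).Prime := ⟨pp.2⟩; placeOf (pilotDataOfK D K) pp.1 x ∉ (pilotDataOfK D K).S → ‖tq pp x‖ = 1)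
  (ht0 : ∀ pp i x, t pp i x ≠ 0)
  (ht : ∀ (pp : Nat.Primes) (i : Fin (pilotDataOfK D K).lstar) (x : (thetaIndex (pilotDataOfK D K)).Fibre (.inr pp)),
    haveI : Fact (pp : ℕ).Prime := ⟨pp.2⟩
    Real.log ‖t pp i x‖ = -((pilotDataOfK D K).thetaPilot i (placeOf (pilotDataOfK D K) pp.1 x)) *
      logNorm K (placeOf (pilotDataOfK D K) pp.1 x) / localDegree K (placeOf (pilotDataOfK D K) pp.1 x))
  (htq : ∀ (pp : Nat.Primes) (x : (thetaIndex (pilotDataOfK D K)).Fibre (.inr pp)),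
    haveI : Fact (pp : ℕ).Prime := ⟨pp.2⟩
    Real.log ‖tq pp x‖ = -((pilotDataOfK D K).qPilot (placeOf (pilotDataOfK D K) pp.1 x)) *
      logNorm K (placeOf (pilotDataOfK D K) pp.1 x) / localDegree K (placeOf (pilotDataOfK D K) pp.1 x))

include htq0 htq ht0 ht in
/-- **Uniformizer reading of REALISING ideles** (`‖ϖ_w‖ = p^{−1/e_w}`, `P_q(w) = P_w ∈ ℕ`): `‖t_{Θ,i+1,w}‖ = ‖ϖ_w‖^{(i+1)²·P_w}`,
`‖t_{q,w}‖ = ‖ϖ_w‖^{P_w}` (Dupuy–Hilado (3.4), abc-iut-w5-d236). [cite: DupuyHilado2025, §3.3, §3.4] -/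
theorem norm_ideles_eq_zpow_uniformizer (pp : Nat.Primes) (i : Fin (pilotDataOfK D K).lstar)
    (w : (thetaIndex (pilotDataOfK D K)).Fibre (.inr pp))
    (ϖ : haveI : Fact (pp : ℕ).Prime := ⟨pp.2⟩; (kOf (pilotDataOfK D K) pp.1 w)ˣ)
    (hϖ : haveI : Fact (pp : ℕ).Prime := ⟨pp.2⟩
      ‖(ϖ : kOf (pilotDataOfK D K) pp.1 w)‖ =
        ((pp : ℕ) : ℝ) ^ (-(1 / ((placeOf (pilotDataOfK D K) pp.1 w).asIdeal.ramificationIdx ℤ : ℝ))))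
    (P : ℕ) (hP : haveI : Fact (pp : ℕ).Prime := ⟨pp.2⟩; (pilotDataOfK D K).qPilot (placeOf (pilotDataOfK D K) pp.1 w) = P) :
    haveI : Fact (pp : ℕ).Prime := ⟨pp.2⟩
    ‖t pp i w‖ = ‖(ϖ : kOf (pilotDataOfK D K) pp.1 w)‖ ^ (((((i : ℕ) + 1) ^ 2 * P : ℕ) : ℤ)) ∧
      ‖tq pp w‖ = ‖(ϖ : kOf (pilotDataOfK D K) pp.1 w)‖ ^ ((P : ℕ) : ℤ) := by
  haveI : Fact (pp : ℕ).Prime := ⟨pp.2⟩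
  have hp0 : (0 : ℝ) < ((pp : ℕ) : ℝ) := by exact_mod_cast pp.2.pos
  have he0 : (0 : ℝ) < ((placeOf (pilotDataOfK D K) pp.1 w).asIdeal.ramificationIdx ℤ : ℝ) := by
    exact_mod_cast ramificationIdx_placeOf_pos D pp w
  have hram : (ramIdx K (placeOf (pilotDataOfK D K) pp.1 w) : ℝ) =
      ((placeOf (pilotDataOfK D K) pp.1 w).asIdeal.ramificationIdx ℤ : ℝ) := by
    rw [ramIdx_eq K (placeOf (pilotDataOfK D K) pp.1 w)]
  -- `p^{-(c)/e} = (p^{-1/e})^{c}` for a natural exponent `c`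
  have key : ∀ m : ℕ, ((pp : ℕ) : ℝ) ^ (-((m : ℝ) * P) / (ramIdx K (placeOf (pilotDataOfK D K) pp.1 w) : ℝ)) =
      ‖(ϖ : kOf (pilotDataOfK D K) pp.1 w)‖ ^ (((m * P : ℕ) : ℤ)) := by
    intro m
    rw [hϖ, zpow_natCast, ← Real.rpow_mul_natCast hp0.le, hram]
    congr 1
    field_simp
    push_cast
    ring
  constructor
  · rw [norm_thetaIdele_eq_rpow_of_realises (pilotDataOfK D K) tq t htq0 ht0 ht htq pp i w, hP]
    have h := key (((i : ℕ) + 1) ^ 2)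
    push_cast at h ⊢
    exact h
  · rw [norm_qIdele_eq_rpow_of_realises (pilotDataOfK D K) tq htq0 htq pp w, hP]
    have h := key 1
    rw [one_mul] at h
    push_cast at h ⊢
    rw [one_mul] at h
    exact h

include htq0 htq ht0 ht in
/-- **«S_H RESTRICTED TO Σ₅» HOLDS (R-H ROUND 2 Q2(5): the first arrow's hypothesis is DISCHARGED).** At the window bed
`settingPrVolSharp (pilotDataOfK D K) …` with REALISING ideles, rh2-q2-eq's `LicenceOn P Σ₅` holds: archimedean packets by the trivial container
(`qRegion_subset_thetaHull_settingDHVolSharp_inl`), primes under no bad place by the identity movers (`…_of_forall_not_mem`), uniformly tame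
packets whose bad places satisfy the H⋆₅ cells by abc-iut-w5-d180's multi-slot movers (`…_of_tame_orders`, window = the cell via
`cell_iff_tame_exact`; good places over the same prime need nothing, `‖t‖ = ‖t_q‖ = 1`); set-level objects of `settingPrVolSharp` = those of
`settingDHVolSharp` (`rfl`). [cite: Mochizuki2012, IUTchIII Step (xi-f) p. 184; IUTchIV Prop. 1.2 (i)(ii) p. 10] [cite: DupuyHilado2025, §3.4, §4.9]
[claim: Mochizuki2012, status: disputed] -/
theorem licenceOn_sigmaFive :
    LicenceOn (settingPrVolSharp (pilotDataOfK D K) hlog M archPk archSub Ψ act Mmod region n lat sig split qData tq t htq0 htq1)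
      (sigmaFive D) := by
  have ht1 := fun pp i x hx => norm_eq_one_of_realises (pilotDataOfK D K) t ht0 ht pp i x hx
  rintro ⟨i, vQ⟩ hmem
  show (settingDHVolSharp (pilotDataOfK D K) hlog M archPk archSub Ψ act Mmod region n lat sig split qData tq t htq0 htq1).qRegion
      (labelSucc i) vQ ⊆
    (settingDHVolSharp (pilotDataOfK D K) hlog M archPk archSub Ψ act Mmod region n lat sig split qData tq t htq0 htq1).thetaHull
      (labelSucc i) vQ
  cases vQ with
  | inl u =>
    exact qRegion_subset_thetaHull_settingDHVolSharp_inl (pilotDataOfK D K) hlog M archPk archSub Ψ act Mmod region n lat sig split qData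
      tq t htq0 htq1 (labelSucc i) u
  | inr pp =>
    haveI hF : Fact (pp : ℕ).Prime := ⟨pp.2⟩
    rcases (mem_sigmaFive_inr_iff D i pp).1 hmem with hS | ⟨⟨hp2, e, hep, he⟩, hcell⟩
    · exact qRegion_subset_thetaHull_settingDHVolSharp_of_forall_not_mem (pilotDataOfK D K) hlog M archPk archSub Ψ act Mmod region n
        lat sig split qData tq t htq0 htq1 i pp ht1 hS
    · -- uniformizers of norm `p^{-1/e}` at every place over `p`
      have hex : ∀ x : (thetaIndex (pilotDataOfK D K)).Fibre (.inr pp),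
          ∃ ϖ : (kOf (pilotDataOfK D K) pp.1 x)ˣ, IsUniformizer ϖ ∧ ‖(ϖ : kOf (pilotDataOfK D K) pp.1 x)‖ =
            ((pp : ℕ) : ℝ) ^ (-(1 / ((placeOf (pilotDataOfK D K) pp.1 x).asIdeal.ramificationIdx ℤ : ℝ))) := fun x =>
        exists_isUniformizer_rescaledCompletion K pp.1 (placeOf (pilotDataOfK D K) pp.1 x) (natCast_mem_placeOf (pilotDataOfK D K) pp.1 x)
      choose ϖ hϖ using hex
      refine qRegion_subset_thetaHull_settingDHVolSharp_of_tame_orders (pilotDataOfK D K) hlog M archPk archSub Ψ act Mmod region n lat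
        sig split qData tq t htq0 htq1 i pp hp2 e hep ϖ (fun x => ⟨he x, (hϖ x).1⟩) fun w => ?_
      by_cases hw : placeOf (pilotDataOfK D K) pp.1 w ∈ (pilotDataOfK D K).S
      · -- a bad place: the orders window is the H⋆₅ cell
        obtain ⟨P, hP, hP1, -⟩ := exists_nat_qPilot_pilotDataOfK D hw
        obtain ⟨hΘn, hqn⟩ := norm_ideles_eq_zpow_uniformizer D tq t htq0 ht0 ht htq pp i w (ϖ w) (hϖ w).2 P hP
        have he0 : (0 : ℤ) < ((placeOf (pilotDataOfK D K) pp.1 w).asIdeal.ramificationIdx ℤ : ℤ) := by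
          exact_mod_cast ramificationIdx_placeOf_pos D pp w
        have hc := (cell_iff_tame_exact he0 (P : ℤ) (((i : ℕ) + 1 : ℕ) : ℤ)).1 (hcell w hw P hP)
        refine Or.inr ⟨((((i : ℕ) + 1) ^ 2 * P : ℕ) : ℤ), ((P : ℕ) : ℤ), hΘn, hqn, ?_, ?_⟩
        · have h1 : 1 ≤ ((i : ℕ) + 1) ^ 2 * P := Nat.one_le_iff_ne_zero.2 (by positivity)
          exact_mod_cast h1
        · rw [← he w]
          push_cast at hc ⊢
          linarith
      · -- a good place over the same prime: both ideles are units
        exact Or.inl (by rw [ht1 pp i w hw, htq1 pp w hw])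

include ht0 ht htq in
/-- **CONVERSELY: at a uniformly tame packet a VIOLATED cell REFUTES the licence** (abc-iut-w4-d006's star form
`not_qRegion_subset_thetaHull_settingDHVolSharp_of_tame_star` at the offending place). [cite: Mochizuki2012, IUTchIV Prop. 1.1 p. 9, Prop. 1.2
(i)(ii) p. 10] [cite: DupuyHilado2025, §3.4, §4.9] [claim: Mochizuki2012, status: disputed] -/
theorem not_mem_licenceCells_of_uniformlyTame_of_not_cell (i : Fin (pilotDataOfK D K).lstar) (pp : Nat.Primes)
    (htame : UniformlyTameAt D pp) (w : (thetaIndex (pilotDataOfK D K)).Fibre (.inr pp)) (P : ℕ)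
    (hP : haveI : Fact (pp : ℕ).Prime := ⟨pp.2⟩; (pilotDataOfK D K).qPilot (placeOf (pilotDataOfK D K) pp.1 w) = P)
    (hnot : haveI : Fact (pp : ℕ).Prime := ⟨pp.2⟩
      ¬ Cell (((placeOf (pilotDataOfK D K) pp.1 w).asIdeal.ramificationIdx ℤ : ℕ) : ℤ) (P : ℤ) (((i : ℕ) + 1 : ℕ) : ℤ)) :
    (i, Sum.inr pp) ∉
      licenceCells (settingPrVolSharp (pilotDataOfK D K) hlog M archPk archSub Ψ act Mmod region n lat sig split qData tq t htq0 htq1) := by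
  haveI hF : Fact (pp : ℕ).Prime := ⟨pp.2⟩
  intro hlic
  change (settingDHVolSharp (pilotDataOfK D K) hlog M archPk archSub Ψ act Mmod region n lat sig split qData tq t htq0 htq1).qRegion
      (labelSucc i) (.inr pp) ⊆
    (settingDHVolSharp (pilotDataOfK D K) hlog M archPk archSub Ψ act Mmod region n lat sig split qData tq t htq0 htq1).thetaHull
      (labelSucc i) (.inr pp) at hlic
  obtain ⟨hp2, e, hep, he⟩ := htame
  have hp0 : (0 : ℝ) < ((pp : ℕ) : ℝ) := by exact_mod_cast pp.2.pos
  have heK : absRamificationIdx (pp : ℕ) (kOf (pilotDataOfK D K) pp.1 w) = e :=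
    (absRamificationIdx_rescaledCompletion K (pp : ℕ) (placeOf (pilotDataOfK D K) pp.1 w)
      (natCast_mem_placeOf (pilotDataOfK D K) pp.1 w)).trans (he w)
  have hew : absRamificationIdx (pp : ℕ) (kOf (pilotDataOfK D K) pp.1 w) ≤ (pp : ℕ) - 2 := heK.le.trans hep
  have hram : (ramIdx K (placeOf (pilotDataOfK D K) pp.1 w) : ℝ) = (e : ℝ) := by
    rw [ramIdx_eq K (placeOf (pilotDataOfK D K) pp.1 w), he w]
  -- norms in the `p^{-(·)/e_K}` form the star refutation wants
  have hΘ' : ‖t pp i w‖ = ((pp : ℕ) : ℝ) ^ (-((((((i : ℕ) + 1) ^ 2 * P : ℕ) : ℤ) : ℝ) /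
      absRamificationIdx (pp : ℕ) (kOf (pilotDataOfK D K) pp.1 w))) := by
    rw [norm_thetaIdele_eq_rpow_of_realises (pilotDataOfK D K) tq t htq0 ht0 ht htq pp i w, hP, hram, heK]
    congr 1
    push_cast
    ring
  have hq' : ‖tq pp w‖ = ((pp : ℕ) : ℝ) ^ (-((((P : ℕ) : ℤ) : ℝ) / absRamificationIdx (pp : ℕ) (kOf (pilotDataOfK D K) pp.1 w))) := by
    rw [norm_qIdele_eq_rpow_of_realises (pilotDataOfK D K) tq htq0 htq pp w, hP, hram, heK]
    congr 1
    push_cast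
    ring
  have he0 : (0 : ℤ) < (e : ℤ) := by
    have := ramificationIdx_placeOf_pos D pp w
    rw [he w] at this
    exact_mod_cast this
  -- the violated cell is the violated exact window, i.e. the star threshold
  have hlt : ((P : ℕ) : ℤ) < (e : ℤ) * ((((((i : ℕ) + 1) ^ 2 * P : ℕ) : ℤ) - 1) / e) + 1 - ((i : ℕ) + 1 : ℕ) * ((e : ℤ) - 1) := by
    have hc : ¬ ((e : ℤ) * ((((((i : ℕ) + 1 : ℕ) : ℤ)) ^ 2 * (P : ℤ) - 1) / e) + 1 - (((i : ℕ) + 1 : ℕ) : ℤ) * ((e : ℤ) - 1) ≤ (P : ℤ)) := by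
      rw [← he w] at he0 ⊢
      exact fun h => hnot ((cell_iff_tame_exact he0 (P : ℤ) (((i : ℕ) + 1 : ℕ) : ℤ)).2 h)
    push_cast at hc ⊢
    linarith [lt_of_not_ge hc]
  have hdeep : ((P : ℕ) : ℤ) + ((i : ℤ) + 1) * ((absRamificationIdx (pp : ℕ) (kOf (pilotDataOfK D K) pp.1 w) : ℤ) - 1) ≤
      (absRamificationIdx (pp : ℕ) (kOf (pilotDataOfK D K) pp.1 w) : ℤ) *
        (((((((i : ℕ) + 1) ^ 2 * P : ℕ) : ℤ)) - 1) / (absRamificationIdx (pp : ℕ) (kOf (pilotDataOfK D K) pp.1 w) : ℤ)) := by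
    rw [heK]
    exact (tame_star_threshold_iff (e : ℤ) ((i : ℤ) + 1) _ _).2 (by push_cast at hlt ⊢; exact not_le.mpr hlt)
  exact not_qRegion_subset_thetaHull_settingDHVolSharp_of_tame_star (pilotDataOfK D K) hlog M archPk archSub Ψ act Mmod region n lat
    sig split qData tq t htq0 htq1 pp i w hp2 hew _ _ hΘ' hq' hdeep hlic

include htq0 htq ht0 ht in
/-- **Σ₅ IS EXACT ON THE UNIFORMLY TAME PACKETS**: there a packet is in Σ₅ iff it is a licence cell. [claim: Mochizuki2012, status: disputed] -/
theorem mem_sigmaFive_iff_mem_licenceCells_of_uniformlyTame (i : Fin (pilotDataOfK D K).lstar) (pp : Nat.Primes)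
    (htame : UniformlyTameAt D pp) :
    (i, Sum.inr pp) ∈ sigmaFive D ↔
      (i, Sum.inr pp) ∈
        licenceCells (settingPrVolSharp (pilotDataOfK D K) hlog M archPk archSub Ψ act Mmod region n lat sig split qData tq t htq0 htq1) := by
  haveI hF : Fact (pp : ℕ).Prime := ⟨pp.2⟩
  constructor
  · intro h
    exact licenceOn_sigmaFive D hlog M archPk archSub Ψ act Mmod region n lat sig split qData tq t htq0 htq1 ht0 ht htq _ h
  · intro hlic
    refine (mem_sigmaFive_inr_iff D i pp).2 (Or.inr ⟨htame, fun w _ P hP => ?_⟩)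
    by_contra hnot
    exact not_mem_licenceCells_of_uniformlyTame_of_not_cell D hlog M archPk archSub Ψ act Mmod region n lat sig split qData tq t htq0 htq1
      ht0 ht htq i pp htame w P hP hnot hlic

/-! ## §3. The weakened Corollary «−|log(q)| ≤ −|log(Θ)| + R_{Σ₅}» at the window bed -/

include ht0 ht htq in
/-- **R-H ROUND 2 Q2(5) — THE WEAKENED COROLLARY FROM «S_H ON Σ₅» (PROVED, not assumed):** at the window bed with realising ideles,
`−|log(Θ)| ∈ ℝ ∧ −|log(q)| ≤ −|log(Θ)| + R_{Σ₅}`, `R_{Σ₅} = offRemainder P (sigmaFive D)` (rh2-q2-eq's `statementUpTo_offRemainder_of_licenceOn`,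
bridge hypotheses by abc-iut-c312-7, §2's `licenceOn_sigmaFive`); the SIZE of `R_{Σ₅}` is §4's business. «follows AS TYPED»; no side taken.
[cite: Mochizuki2012, IUTchIII Cor. 3.12 p. 173–174, Prop. 3.9 (i)(iii) p. 116] [claim: Mochizuki2012, status: disputed] -/
theorem statementUpTo_offRemainder_sigmaFive :
    StatementUpTo (settingPrVolSharp (pilotDataOfK D K) hlog M archPk archSub Ψ act Mmod region n lat sig split qData tq t htq0 htq1)
      (offRemainder (settingPrVolSharp (pilotDataOfK D K) hlog M archPk archSub Ψ act Mmod region n lat sig split qData tq t htq0 htq1)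
        (sigmaFive D)) := by
  have ht1 := fun pp i x hx => norm_eq_one_of_realises (pilotDataOfK D K) t ht0 ht pp i x hx
  exact statementUpTo_offRemainder_of_licenceOn
    (bridgeHyps_settingPrVolSharp_of_ideles (pilotDataOfK D K) hlog M archPk archSub Ψ act Mmod region n lat sig split qData t tq ht0 ht1
      htq0 htq1)
    (licenceOn_sigmaFive D hlog M archPk archSub Ψ act Mmod region n lat sig split qData tq t htq0 htq1 ht0 ht htq)

/-! ## §4. The off-Σ remainder is at most the off-Σ Θ–q FLOOR `(j² − 1)·(−qLocal)` (any stratum) -/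

include ht0 ht htq in
/-- **THE OFF-Σ REMAINDER IS AT MOST THE OFF-Σ Θ–q FLOOR** (every stratum `σ`, realising ideles):
`R_σ ≤ PN(i ↦ Σᶠ_{v_ℚ} 1_{σᶜ}(i, v_ℚ)·((i+1)² − 1)·(−qLocal_{i+1,v_ℚ}))` — a cell's deficit is at most «q-volume − volume of the (Ind3)-region»
(rh2-q2-eq's `offRemainder_le_offImageGap` along `imageChoice` := the Θ-region) and THAT volume is `(i+1)²·qLocal` (abc-iut-C-cert-1's
`PinnedHonestReal.scaled_settingPrVolSharp`, `P_Θ = j²·P_q`); `qLocal ≤ 0`. Genuine currency: `−qLocal_{j,p} = (1/[K:ℚ])·Σ_{x|p} P_q(x)·log N(x)`,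
so for row 5 the charge is `((l²+l−12)/(24l))·log(q_{off Σ₅})`. [cite: Mochizuki2012, IUTchIV Thm. 1.10 Step (v) p. 27–29]
[cite: DupuyHilado2025, §3.3, §3.4, Thm. 3.10.1] [claim: Mochizuki2012, status: disputed] -/
theorem offRemainder_le_offFloor
    (σ : Set (Fin (thetaIndex (pilotDataOfK D K)).lstar × (thetaIndex (pilotDataOfK D K)).VQ)) :
    offRemainder (settingPrVolSharp (pilotDataOfK D K) hlog M archPk archSub Ψ act Mmod region n lat sig split qData tq t htq0 htq1) σ ≤
      processionNormalized fun i : Fin (thetaIndex (pilotDataOfK D K)).lstar =>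
        ∑ᶠ vQ : (thetaIndex (pilotDataOfK D K)).VQ, σᶜ.indicator
          (fun c : Fin (thetaIndex (pilotDataOfK D K)).lstar × (thetaIndex (pilotDataOfK D K)).VQ =>
            ((((c.1 : ℕ) + 1 : ℕ) : ℝ) ^ 2 - 1) *
              (-(settingPrVolSharp (pilotDataOfK D K) hlog M archPk archSub Ψ act Mmod region n lat sig split qData tq t htq0
                htq1).qLocal (labelSucc c.1) c.2))
          (i, vQ) := by
  have ht1 := fun pp i x hx => norm_eq_one_of_realises (pilotDataOfK D K) t ht0 ht pp i x hx
  set P := settingPrVolSharp (pilotDataOfK D K) hlog M archPk archSub Ψ act Mmod region n lat sig split qData tq t htq0 htq1 with hPdef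
  have HB : BridgeHyps P :=
    bridgeHyps_settingPrVolSharp_of_ideles (pilotDataOfK D K) hlog M archPk archSub Ψ act Mmod region n lat sig split qData t tq ht0 ht1
      htq0 htq1
  -- the global choice: the (Ind3)-enlarged Θ-region in every packet
  let U : ImageChoice P := ⟨fun c => P.thetaRegion3 _ c.2, fun c => P.thetaRegion3_mem_possibleImages _ c.2⟩
  refine (offRemainder_le_offImageGap HB σ U).trans (le_of_eq ?_)
  unfold offImageGap
  refine congrArg processionNormalized (funext fun i => finsum_congr fun vQ => ?_)
  by_cases hc : (i, vQ) ∈ σᶜ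
  · rw [Set.indicator_of_mem hc, Set.indicator_of_mem hc]
    -- honest scaling: `logvol(thetaRegion3) = (i+1)²·qLocal`, and `qLocal ≤ 0`
    have hsc := PinnedHonestReal.scaled_settingPrVolSharp (pilotDataOfK D K) hlog M archPk archSub Ψ act Mmod region n lat sig split
      qData t tq ht0 ht htq0 htq1 htq i vQ
    have hq0 : P.qLocal (labelSucc i) vQ ≤ 0 := by
      cases vQ with
      | inl u =>
        exact le_of_eq (qLocal_settingPrVol_qCentreDH_inl (pilotDataOfK D K) hlog M archPk archSub Ψ act Mmod region n lat sig split
          qData _ tq htq0 _ (labelSucc i) u)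
      | inr pp =>
        exact qLocal_settingPrVolSharp_nonpos (pilotDataOfK D K) hlog M archPk archSub Ψ act Mmod region n lat sig split qData t tq htq0
          htq1 htq (labelSucc i) pp
    show max (P.qLocal (labelSucc i) vQ - ((situationPrVol (pilotDataOfK D K) hlog M archPk archSub Ψ act Mmod region).D n).logvol
        (labelSucc i) vQ (P.thetaRegion3 (labelSucc i) vQ)) 0 =
      ((((i : ℕ) + 1 : ℕ) : ℝ) ^ 2 - 1) * (-P.qLocal (labelSucc i) vQ)
    rw [hsc]
    have hj : (1 : ℝ) ≤ (((i : ℕ) + 1 : ℕ) : ℝ) ^ 2 := by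
      have : (1 : ℝ) ≤ (((i : ℕ) + 1 : ℕ) : ℝ) := by exact_mod_cast Nat.succ_le_succ (Nat.zero_le _)
      nlinarith
    rw [max_eq_left (by nlinarith)]
    ring
  · rw [Set.indicator_of_notMem hc, Set.indicator_of_notMem hc]

include ht0 ht htq in
/-- **Hence the weakened Corollary with the FLOOR as the error**: «S_H on Σ₅» (discharged) gives
`−|log(q)| ≤ −|log(Θ)| + PN(Σ_{off Σ₅} ((i+1)²−1)·(−qLocal))` at the window bed. [claim: Mochizuki2012, status: disputed] -/
theorem statementUpTo_offFloor_sigmaFive :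
    StatementUpTo (settingPrVolSharp (pilotDataOfK D K) hlog M archPk archSub Ψ act Mmod region n lat sig split qData tq t htq0 htq1)
      (processionNormalized fun i : Fin (thetaIndex (pilotDataOfK D K)).lstar =>
        ∑ᶠ vQ : (thetaIndex (pilotDataOfK D K)).VQ, (sigmaFive D)ᶜ.indicator
          (fun c : Fin (thetaIndex (pilotDataOfK D K)).lstar × (thetaIndex (pilotDataOfK D K)).VQ =>
            ((((c.1 : ℕ) + 1 : ℕ) : ℝ) ^ 2 - 1) *
              (-(settingPrVolSharp (pilotDataOfK D K) hlog M archPk archSub Ψ act Mmod region n lat sig split qData tq t htq0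
                htq1).qLocal (labelSucc c.1) c.2))
          (i, vQ)) :=
  statementUpTo_mono
    (offRemainder_le_offFloor D hlog M archPk archSub Ψ act Mmod region n lat sig split qData tq t htq0 htq1 ht0 ht htq (sigmaFive D))
    (statementUpTo_offRemainder_sigmaFive D hlog M archPk archSub Ψ act Mmod region n lat sig split qData tq t htq0 htq1 ht0 ht htq)

end Summit.ABC.IUTFork.Repair.RH.TameBandLicenceSigma

end
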